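import Literature.AlgebraicGeometry.Resolution.EmbeddedResolutionExcellentSurfacesSequence
import Literature.AlgebraicGeometry.Resolution.MonomialOrderReductionUnit
import Literature.AlgebraicGeometry.Resolution.BlowupsIntegral
import Literature.AlgebraicGeometry.Resolution.StalkIdealLemmas
import Literature.AlgebraicGeometry.Resolution.EtaleVanishingIdeal
import Literature.AlgebraicGeometry.Resolution.RegularCentreComponents
import Literature.AlgebraicGeometry.Resolution.MarkedIdealsLemmas
import Mathlib.RingTheory.RegularLocalRing.Defs
import HarnessLib

/-!
# Crux `PatchingRelPerfect` (stmt-ResolutionOfSingularities-16161), chain W5.2 — T6-E1b residual, the `SingCentres₃`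
# discharge (RESTART loop): a Sing-centred sequence is an ISOMORPHISM OVER THE REGULAR LOCUS, and the regular locus
# stays DENSE in the strict transforms

[OURS · L1 W5.2 · `SingCentres₃` discharge = RESTART AT THE FIRST REGULAR COMPONENT (res-L1-w52-plan-1 RULING R4 (3); res-type-049,
TAKING 2026-08-27T12:39Z; OWNER NOTE O3.1), brick R2 «over the regular locus», F-72-INDEPENDENT] Fact-free; NOT statements of the
manuscript under review.

THE POINT (the TERMINATION MEASURE of the restart loop). Fix an open `U₀ ⊆ E` meeting the closed `X` in REGULAR points of its
reduced structure, densely (`X ⊆ cl (X ∩ U₀)`; in the loop `U₀ = E ∖ Sing X`). Along any sequence of blowings up in the tree's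
per-step predicate `IsBPermissibleSequence X B σ X' B'` — every centre inside the SINGULAR locus of the current strict transform —
no centre ever meets `σ⁻¹U₀`, so: the stalk maps of `σ` are isomorphisms over `U₀` and `σ` is injective on `σ⁻¹U₀` (the blowing
up is an isomorphism off its centre, Stacks 02OS); the strict transform over `U₀` is the total transform, `X' ∩ σ⁻¹U₀ = σ⁻¹(X ∩ U₀)`;
its points are REGULAR points of `cl X'`; and `X' ∩ σ⁻¹U₀` is DENSE in `X'` (open maps pull closures back). Consequence for the
loop: a nonempty clopen (frozen) piece of a strict transform has a point over `U₀`, not hit by the rest — the image in `E` of the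
unfrozen part strictly decreases at every restart (Noetherian induction on closed subsets of `E`).

* `stalkIdeal_vanishingIdeal_eq_of_inter_eq` — stalks of `𝓘(T)` only see `T` near the point;
* `isRegularLocalRing_quotient_of_preimage` — regularity of `𝒪 ⧸ 𝓘(T)` transported along a stalk isomorphism to the preimage;
* `seq_over_regularLocus` — **MAIN** (the five invariants along `IsBPermissibleSequence`);
* `exists_mem_not_mem_image` — the measure step: a nonempty relatively-open piece of `X'` disjoint from `Y' ⊆ X'` has a point
  over `U₀` outside `σ(Y')`.

AI-written; AI review is weaker than expert review.

## References
* V. Cossart, U. Jannsen, S. Saito, LNM 2270 (2020), (6.2), Thm. 6.9 (a) («isomorphism over the quasi-regular locus»).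
  [CossartJannsenSaito2020]
* U. Görtz, T. Wedhorn, *Algebraic Geometry I* (2nd ed. 2020), Prop. 13.91 (3). [GortzWedhorn2020]
* The Stacks Project, Tag 02OS. [StacksProject]
-/

-- `Summit.<Summit>.<Sub>.Theorems` with `Sub = Summit` (single-conjunct summit, D-0017)
set_option linter.dupNamespace false

noncomputable section

open CategoryTheory CategoryTheory.Limits AlgebraicGeometry TopologicalSpace IsLocalRing
open Literature.AlgebraicGeometry.Resolution Scheme.IdealSheafData

namespace Summit.ResolutionOfSingularities.ResolutionOfSingularities.Theorems

universe u

namespace LegalRestart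

variable {Z : Scheme.{u}}

/-! ## §1 Stalks of vanishing ideals are local -/

/-- **The stalk of `𝓘(T)` at `y` only depends on `T` near `y`**: closed `T, T'` agreeing on an open `W ∋ y` have the same
stalk there (`𝓘(T ∪ Wᶜ) = 𝓘(T) ⊓ 𝓘(Wᶜ)` and `𝓘(Wᶜ)_y = 𝒪_y`). [folklore] -/
theorem stalkIdeal_vanishingIdeal_eq_of_inter_eq {T T' : Closeds Z} {W : Set Z} (hW : IsOpen W) {y : Z} (hy : y ∈ W)
    (h : (T : Set Z) ∩ W = (T' : Set Z) ∩ W) :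
    stalkIdeal (vanishingIdeal T) y = stalkIdeal (vanishingIdeal T') y := by
  set K : Closeds Z := ⟨Wᶜ, hW.isClosed_compl⟩ with hK
  have hyK : y ∉ (K : Set Z) := fun h' => h' hy
  have hTK : T ⊔ K = T' ⊔ K := by
    ext z
    simp only [Closeds.coe_sup, Closeds.coe_mk, Set.mem_union, Set.mem_compl_iff, hK]
    by_cases hz : z ∈ W
    · have h1 : z ∈ (T : Set Z) ∩ W ↔ z ∈ (T' : Set Z) ∩ W := by rw [h]
      simp only [Set.mem_inter_iff, hz, and_true] at h1
      rw [h1]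
    · simp [hz]
  have e1 : stalkIdeal (vanishingIdeal (T ⊔ K)) y = stalkIdeal (vanishingIdeal T) y := by
    rw [Scheme.IdealSheafData.vanishingIdeal_sup, stalkIdeal_inf, stalkIdeal_vanishingIdeal_of_not_mem hyK, inf_top_eq]
  have e2 : stalkIdeal (vanishingIdeal (T' ⊔ K)) y = stalkIdeal (vanishingIdeal T') y := by
    rw [Scheme.IdealSheafData.vanishingIdeal_sup, stalkIdeal_inf, stalkIdeal_vanishingIdeal_of_not_mem hyK, inf_top_eq]
  rw [← e1, hTK, e2]

/-- **Regularity of the reduced structure transported to a preimage along a stalk isomorphism**: if `σ.stalkMap y` is an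
isomorphism, `𝒪_{E,σ y} ⧸ 𝓘(T)_{σ y}` regular ⇒ `𝒪_{Z,y} ⧸ 𝓘(σ⁻¹T)_y` regular (`𝓘(σ⁻¹T)_y = √(𝓘(T)_{σ y} 𝒪_y)`, and the image of a
radical ideal under an isomorphism is radical). [cite: StacksProject, Tag 02OS] -/
theorem isRegularLocalRing_quotient_of_preimage {E : Scheme.{u}} (σ : Z ⟶ E) (T : Closeds E) {y : Z} [IsIso (σ.stalkMap y)]
    (hreg : IsRegularLocalRing (E.presheaf.stalk (σ y) ⧸ stalkIdeal (vanishingIdeal T) (σ y))) :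
    IsRegularLocalRing (Z.presheaf.stalk y ⧸ stalkIdeal (vanishingIdeal (T.preimage σ.continuous)) y) := by
  let φ : E.presheaf.stalk (σ y) ≃+* Z.presheaf.stalk y := (asIso (σ.stalkMap y)).commRingCatIsoToRingEquiv
  have hφ : (φ : E.presheaf.stalk (σ y) →+* Z.presheaf.stalk y) = (σ.stalkMap y).hom := rfl
  -- the image of the radical stalk ideal under the isomorphism is radical
  have hrad : ((stalkIdeal (vanishingIdeal T) (σ y)).map (σ.stalkMap y).hom).IsRadical := by
    rw [← hφ, Ideal.map_comap_of_equiv (I := stalkIdeal (vanishingIdeal T) (σ y)) φ]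
    exact (isRadical_stalkIdeal_vanishingIdeal T (σ y)).comap _
  have hI : stalkIdeal (vanishingIdeal (T.preimage σ.continuous)) y =
      (stalkIdeal (vanishingIdeal T) (σ y)).map (φ : E.presheaf.stalk (σ y) →+* Z.presheaf.stalk y) := by
    rw [stalkIdeal_vanishingIdeal_preimage, hφ, hrad.radical]
  haveI := hreg
  exact IsRegularLocalRing.of_ringEquiv (Ideal.quotientEquiv _ _ φ hI)

/-! ## §2 The invariants along a Sing-centred sequence -/

/-- **Regular points over `U₀`** (from two of the invariants): if the stalk maps of `σ` are isomorphisms over `U₀` and the closed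
`X'` agrees with `σ⁻¹X` over `U₀`, then at every point of `X' ∩ σ⁻¹U₀` the reduced structure of `X'` is regular, `X ∩ U₀` consisting
of regular points of the reduced structure of `X`. [cite: StacksProject, Tag 02OS] -/
theorem isRegularLocalRing_quotient_over {E : Scheme.{u}} {σ : Z ⟶ E} {X : Set E} (hX : IsClosed X) (U₀ : E.Opens)
    (hreg : ∀ x ∈ X ∩ (U₀ : Set E), IsRegularLocalRing (E.presheaf.stalk x ⧸ stalkIdeal (vanishingIdeal ⟨X, hX⟩) x))
    {X' : Set Z} (hX' : IsClosed X') (hiso : ∀ y : Z, σ y ∈ (U₀ : Set E) → IsIso (σ.stalkMap y))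
    (hI : X' ∩ σ ⁻¹' (U₀ : Set E) = σ ⁻¹' (X ∩ (U₀ : Set E))) {y : Z} (hy : y ∈ X' ∩ σ ⁻¹' (U₀ : Set E)) :
    IsRegularLocalRing (Z.presheaf.stalk y ⧸ stalkIdeal (vanishingIdeal ⟨X', hX'⟩) y) := by
  have hyU : σ y ∈ (U₀ : Set E) := hy.2
  have hyX : σ y ∈ X ∩ (U₀ : Set E) := by
    have h := hy; rw [hI] at h; exact h
  haveI := hiso y hyU
  -- `X'` and `σ⁻¹X` agree on the open `σ⁻¹U₀ ∋ y`
  have hloc : stalkIdeal (vanishingIdeal (⟨X', hX'⟩ : Closeds Z)) y =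
      stalkIdeal (vanishingIdeal ((⟨X, hX⟩ : Closeds E).preimage σ.continuous)) y := by
    refine stalkIdeal_vanishingIdeal_eq_of_inter_eq (U₀.2.preimage σ.continuous) hyU ?_
    show X' ∩ σ ⁻¹' (U₀ : Set E) = σ ⁻¹' X ∩ σ ⁻¹' (U₀ : Set E)
    rw [hI, Set.preimage_inter]
  rw [hloc]
  exact isRegularLocalRing_quotient_of_preimage σ ⟨X, hX⟩ (hreg (σ y) hyX)

/-- **A SING-CENTRED SEQUENCE IS AN ISOMORPHISM OVER THE REGULAR LOCUS, WHICH STAYS DENSE** (see the module docstring): along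
`IsBPermissibleSequence X B σ X' B'`, with `U₀` open, `X ∩ U₀` regular points of `𝓘(X)` and dense in `X`: `X'` is closed; the stalk
maps of `σ` over `U₀` are isomorphisms; `σ` is injective on `σ⁻¹U₀`; `X' ∩ σ⁻¹U₀ = σ⁻¹(X ∩ U₀)`; and `X' ⊆ cl (X' ∩ σ⁻¹U₀)`.
[cite: CossartJannsenSaito2020, Thm. 6.9 (a)] [cite: GortzWedhorn2020, Prop. 13.91 (3)] [cite: StacksProject, Tag 02OS] -/
theorem seq_over_regularLocus {E : Scheme.{u}} {X B : Set E} (hX : IsClosed X) (U₀ : E.Opens)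
    (hreg : ∀ x ∈ X ∩ (U₀ : Set E), IsRegularLocalRing (E.presheaf.stalk x ⧸ stalkIdeal (vanishingIdeal ⟨X, hX⟩) x))
    (hdense : X ⊆ closure (X ∩ (U₀ : Set E))) :
    ∀ {Z' : Scheme.{u}} {σ : Z' ⟶ E} {X' B' : Set Z'}, IsBPermissibleSequence X B σ X' B' →
      IsClosed X' ∧
      (∀ y : Z', σ y ∈ (U₀ : Set E) → IsIso (σ.stalkMap y)) ∧
      Set.InjOn σ (σ ⁻¹' (U₀ : Set E)) ∧
      X' ∩ σ ⁻¹' (U₀ : Set E) = σ ⁻¹' (X ∩ (U₀ : Set E)) ∧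
      X' ⊆ closure (X' ∩ σ ⁻¹' (U₀ : Set E)) := by
  intro Z' σ X' B' h
  induction h with
  | refl =>
    refine ⟨hX, fun y _ => ?_, fun a _ b _ hab => by simpa using hab, ?_, ?_⟩
    · rw [Scheme.Hom.stalkMap_id]; exact IsIso.id _
    · ext y; simp
    · simpa using hdense
  | @blowup Z' Z'' σ X' B' h C τ hτ hreg' hsub hsing hperm hnc ih =>
    obtain ⟨hX'c, hiso, hinj, hI, hden⟩ := ih
    set V : Set Z' := σ ⁻¹' (U₀ : Set E) with hVdef
    have hVo : IsOpen V := U₀.2.preimage σ.continuous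
    -- the centre lies in `X'` and misses `σ⁻¹U₀` (its points are singular points of `cl X' = X'`)
    have hCX : (C.support : Set Z') ⊆ X' := by
      intro y hy
      have h' : y ∈ ((vanishingIdeal (⟨closure X', isClosed_closure⟩ : Closeds Z')).support : Set Z') := support_antitone hsub hy
      rw [Scheme.IdealSheafData.coe_support_vanishingIdeal, Closeds.coe_mk, hX'c.closure_eq] at h'
      exact h'
    have hcl : (⟨closure X', isClosed_closure⟩ : Closeds Z') = ⟨X', hX'c⟩ := Closeds.ext hX'c.closure_eq
    have hCV : Disjoint (C.support : Set Z') V := by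
      refine Set.disjoint_left.mpr fun y hyC hyV => hsing y hyC ?_
      rw [hcl]
      exact isRegularLocalRing_quotient_over hX U₀ hreg hX'c hiso hI ⟨hCX hyC, hyV⟩
    -- preimage bookkeeping
    have hpre : ⇑(τ ≫ σ) ⁻¹' (U₀ : Set E) = τ ⁻¹' V := by
      ext z; simp only [Set.mem_preimage, Scheme.Hom.comp_apply, hVdef]
    have hτV : ∀ {z : Z''}, τ z ∈ V → τ z ∉ (C.support : Set Z') := fun hz hzC => Set.disjoint_left.mp hCV hzC hz
    refine ⟨isClosed_closure, fun z hz => ?_, ?_, ?_, ?_⟩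
    · -- stalk maps over `U₀`
      have hzV : τ z ∈ V := by have h' := hz; rwa [Scheme.Hom.comp_apply] at h'
      rw [Scheme.Hom.stalkMap_comp]
      exact @IsIso.comp_isIso _ _ _ _ _ _ _ (hiso (τ z) hzV) (hτ.isIso_stalkMap_of_not_mem_support (hτV hzV))
    · -- injectivity over `U₀`
      intro a ha b hb hab
      rw [hpre] at ha hb
      have hab' : σ (τ a) = σ (τ b) := by simpa [Scheme.Hom.comp_apply] using hab
      have h1 : τ a = τ b := hinj ha hb hab'
      -- `τ` is injective off its centre
      set W : Z'.Opens := centreCompl C with hW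
      haveI : IsIso (τ ∣_ W) := hτ.isIso_compl
      have ha' : a ∈ τ ⁻¹ᵁ W := by show τ a ∈ ((C.support : Set Z')ᶜ); exact hτV ha
      have hb' : b ∈ τ ⁻¹ᵁ W := by show τ b ∈ ((C.support : Set Z')ᶜ); exact hτV hb
      have heq : (τ ∣_ W) ⟨a, ha'⟩ = (τ ∣_ W) ⟨b, hb'⟩ := by
        apply Subtype.ext
        rw [morphismRestrict_base_coe, morphismRestrict_base_coe]
        exact h1
      exact congrArg Subtype.val ((τ ∣_ W).isOpenEmbedding.injective heq)
    · -- the strict transform over `U₀` is the total transform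
      rw [hpre]
      ext z
      simp only [Set.mem_inter_iff, Set.mem_preimage, Scheme.Hom.comp_apply]
      constructor
      · rintro ⟨hz, hzV⟩
        have h1 : τ z ∈ X' := by
          have : z ∈ τ ⁻¹' X' := closure_minimal (Set.preimage_mono Set.sdiff_subset) (hX'c.preimage τ.continuous) hz
          exact this
        have h2 : τ z ∈ X' ∩ V := ⟨h1, hzV⟩
        rw [hI] at h2
        exact h2
      · rintro ⟨hzX, hzU⟩
        have h2 : τ z ∈ X' ∩ V := by rw [hI]; exact ⟨hzX, hzU⟩
        exact ⟨subset_closure ⟨h2.1, hτV h2.2⟩, h2.2⟩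
    · -- density over `U₀` persists (the blowing up is an open map off its centre)
      rw [hpre]
      -- it suffices to catch `τ⁻¹(X' ∖ V(C))`
      suffices hsuff : τ ⁻¹' (X' \ (C.support : Set Z')) ⊆ closure (τ ⁻¹' (X' ∩ V)) by
        have h1 : τ ⁻¹' (X' ∩ V) ⊆ closure (τ ⁻¹' (X' \ (C.support : Set Z'))) ∩ τ ⁻¹' V := fun z hz =>
          ⟨subset_closure ⟨hz.1, hτV hz.2⟩, hz.2⟩
        calc closure (τ ⁻¹' (X' \ (C.support : Set Z')))
            ⊆ closure (closure (τ ⁻¹' (X' ∩ V))) := closure_mono hsuff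
          _ = closure (τ ⁻¹' (X' ∩ V)) := closure_closure
          _ ⊆ closure (closure (τ ⁻¹' (X' \ (C.support : Set Z'))) ∩ τ ⁻¹' V) := closure_mono h1
      intro z hz
      obtain ⟨hzX, hzC⟩ := hz
      -- work on the open `O = τ⁻¹(Z' ∖ V(C))`, over which `τ` is an open immersion
      set W : Z'.Opens := centreCompl C with hW
      let j : ((τ ⁻¹ᵁ W : Z''.Opens) : Scheme.{u}) ⟶ Z' := (τ ⁻¹ᵁ W).ι ≫ τ
      haveI : IsOpenImmersion j := hτ.isOpenImmersion_preimage_compl_ι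
      have hzW : z ∈ τ ⁻¹ᵁ W := hzC
      have hjopen : IsOpenMap j := j.isOpenEmbedding.isOpenMap
      -- `τ z ∈ cl (X' ∩ V)`
      have h1 : τ z ∈ closure (X' ∩ V) := hden hzX
      have h2 : (⟨z, hzW⟩ : (τ ⁻¹ᵁ W : Z''.Opens)) ∈ j ⁻¹' closure (X' ∩ V) := by
        show j ⟨z, hzW⟩ ∈ closure (X' ∩ V)
        have : j ⟨z, hzW⟩ = τ z := by simp [j]
        rw [this]; exact h1
      have h3 := hjopen.preimage_closure_subset_closure_preimage h2
      -- push forward along the inclusion of the open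
      have h4 : ((τ ⁻¹ᵁ W).ι : _ ⟶ Z'') '' (j ⁻¹' (X' ∩ V)) ⊆ τ ⁻¹' (X' ∩ V) := by
        rintro _ ⟨w, hw, rfl⟩
        have : j w = τ ((τ ⁻¹ᵁ W).ι w) := by simp [j]
        show τ ((τ ⁻¹ᵁ W).ι w) ∈ X' ∩ V
        rw [← this]; exact hw
      have h5 : z ∈ ((τ ⁻¹ᵁ W).ι : _ ⟶ Z'') '' closure (j ⁻¹' (X' ∩ V)) :=
        ⟨⟨z, hzW⟩, h3, by simp⟩
      exact closure_mono h4 (image_closure_subset_closure_image (τ ⁻¹ᵁ W).ι.continuous h5)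

/-! ## §3 The measure step -/

/-- **A nonempty relatively-open piece `F` of `X'` has a point over `U₀` whose image is not in `σ(Y')`** for any `Y' ⊆ X'` disjoint
from `F` (density gives the point; injectivity over `U₀` keeps `Y'` away from its image). In the restart loop: `F` = the newly
frozen regular components, `Y'` = the new unfrozen part, so `cl σ(Y') ⊊ cl σ(Y)` — Noetherian induction on closed subsets of `E`.
[cite: CossartJannsenSaito2020, Cor. 6.26] -/
theorem exists_mem_not_mem_image {E : Scheme.{u}} {σ : Z ⟶ E} (U₀ : E.Opens) {X' F Y' : Set Z}
    (hinj : Set.InjOn σ (σ ⁻¹' (U₀ : Set E))) (hden : X' ⊆ closure (X' ∩ σ ⁻¹' (U₀ : Set E)))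
    (hFX : F ⊆ X') (hFo : ∃ O : Set Z, IsOpen O ∧ X' ∩ O = F) (hFne : F.Nonempty) (hd : Disjoint F Y') :
    ∃ ξ ∈ F, σ ξ ∈ (U₀ : Set E) ∧ σ ξ ∉ σ '' Y' := by
  obtain ⟨O, hO, hOF⟩ := hFo
  obtain ⟨f, hf⟩ := hFne
  -- `F` meets the dense open `X' ∩ σ⁻¹U₀`
  have hfcl : f ∈ closure (X' ∩ σ ⁻¹' (U₀ : Set E)) := hden (hFX hf)
  have hfO : f ∈ O := by
    have : f ∈ X' ∩ O := by rw [hOF]; exact hf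
    exact this.2
  obtain ⟨ξ, hξO, hξX, hξU⟩ := mem_closure_iff.mp hfcl O hO hfO
  have hξF : ξ ∈ F := by rw [← hOF]; exact ⟨hξX, hξO⟩
  refine ⟨ξ, hξF, hξU, ?_⟩
  rintro ⟨y, hy, hyξ⟩
  have hyU : y ∈ σ ⁻¹' (U₀ : Set E) := by
    show σ y ∈ (U₀ : Set E); rw [hyξ]; exact hξU
  have : y = ξ := hinj hyU hξU hyξ
  exact Set.disjoint_left.mp hd hξF (this ▸ hy)

end LegalRestart

end Summit.ResolutionOfSingularities.ResolutionOfSingularities.Theorems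

end
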